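import Literature.InformationTheory.QuantumCodes.MatchingDecoders
import HarnessLib

/-!
# Matching decoders exist for EVERY graphlike model (no connectivity hypothesis): the extended
# shortest-chain metric

Topic `Literature/InformationTheory/QuantumCodes` (venture QEC, LADDER-QEC Q5 «toric/surface + MWPM»; qec-type-09 gen 4).
Companion of `MatchingDecoders.lean`. There `exists_isMatchingDecoder` builds a minimum-weight-perfect-matching
decoder for the shortest-chain metric of a LINK-CONNECTED model (Korte–Vygen Thm 12.9 works in the metric closure
`(Ḡ, c̄)` of a connected graph; Prop 12.6: a `T`-join exists iff every component meets `T` evenly). Codes with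
boundaries, disconnected detector graphs and degenerate windows (`T = 0` rounds) are not link-connected, yet MWPM is
still well defined: pairs of defects in different components simply never get matched. This file PROVES it in
general (0 facts): with the **extended shortest-chain metric** `extDist` — `chainDist` on joined pairs, the constant
`|E| + 1` (longer than every chain) on pairs no chain joins — `extMetric ι : EdgeMetric ι` for EVERY `ι`, and
`exists_isMatchingDecoder_extMetric : ∃ D, IsMatchingDecoder (extMetric ι) D`: a minimum-cost perfect matching of
the defects of an actual error never uses an unjoined pair (its cost is `≤ |e| ≤ |E|` by Korte–Vygen Lemma 12.8),
so geodesics exist where needed. Hence `Decoder.IsMinWeight` decoders obtained by matching exist for every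
graphlike (or graphlike-with-boundary, `MatchingDecodersBoundary.lean`) sector, e.g. planar surface codes.

## References
* [KorteVygen2002] B. Korte, J. Vygen, *Combinatorial Optimization*, 2nd ed., Springer (2002), §12.2 Prop 12.6,
  Lemma 12.8, Thm 12.9 (Edmonds–Johnson), pp. 276–277.
* [DennisEtAl2002] E. Dennis, A. Kitaev, A. Landahl, J. Preskill, *Topological quantum memory*, J. Math. Phys. 43
  (2002) 4452–4505, arXiv:quant-ph/0110143, §4.4 p. 18.
-/

namespace Literature.InformationTheory.QuantumCodes

open Finset Matrix Literature.Barriers.PneNP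

variable {V E : Type*}

section Existence

variable [DecidableEq V] [Fintype E] {ι : E → Sym2 V}

/-- The pair `p` is **joined**: some chain has boundary `pairIndicator p` (for `p = s(a, b)`: `a` and `b` lie
in the same component; always true for `a = b`). (definition) [cite: KorteVygen2002, §12.2 Prop 12.6 (vᵢ and wᵢ in the same connected component)] -/
def Joined (ι : E → Sym2 V) (p : Sym2 V) : Prop :=
  ∃ γ : E → ZMod 2, graphSyn ι γ = pairIndicator p

/-- Every site is joined to itself (empty chain). [cite: KorteVygen2002, §12.2 Prop 12.6] -/
theorem joined_diag (a : V) : Joined ι s(a, a) :=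
  ⟨0, by rw [graphSyn_zero, pairIndicator_diag]⟩

/-- Joinedness is transitive (concatenate chains). [cite: KorteVygen2002, §12.2 Prop 12.6 proof (E(P₁) △ E(P₂))] -/
theorem Joined.trans {a b c : V} (h₁ : Joined ι s(a, b)) (h₂ : Joined ι s(b, c)) : Joined ι s(a, c) := by
  obtain ⟨γ₁, h₁⟩ := h₁
  obtain ⟨γ₂, h₂⟩ := h₂
  exact ⟨γ₁ + γ₂, by rw [graphSyn_add, h₁, h₂, pairIndicator_add_pairIndicator]⟩

/-- The two ends of a link are joined. [cite: KorteVygen2002, §12.2 Def 12.5] -/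
theorem joined_ends [DecidableEq E] (ℓ : E) : Joined ι (ι ℓ) :=
  ⟨Pi.single ℓ 1, graphSyn_single ℓ⟩

/-- A joined pair has a chain of exactly `chainDist` links. [cite: KorteVygen2002, §12.2 proof of Thm 12.9 (shortest paths)] -/
theorem Joined.exists_chain {a b : V} (h : Joined ι s(a, b)) :
    ∃ γ : E → ZMod 2, graphSyn ι γ = pairIndicator s(a, b) ∧ hammingNorm γ = chainDist ι a b := by
  obtain ⟨γ, hγ⟩ := h
  exact Nat.sInf_mem (s := {n | ∃ γ : E → ZMod 2, graphSyn ι γ = pairIndicator s(a, b) ∧ hammingNorm γ = n})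
    ⟨hammingNorm γ, γ, hγ, rfl⟩

/-- The shortest-chain distance never exceeds the number of links. [cite: KorteVygen2002, §12.2 proof of Thm 12.9] -/
theorem chainDist_le_card (a b : V) : chainDist ι a b ≤ Fintype.card E := by
  by_cases h : Joined ι s(a, b)
  · obtain ⟨γ, hγ, hn⟩ := h.exists_chain
    rw [← hn]
    exact hammingNorm_le_card_fintype
  · have hempty : {n | ∃ γ : E → ZMod 2, graphSyn ι γ = pairIndicator s(a, b) ∧ hammingNorm γ = n} = ∅ := by
      ext n
      simp only [Set.mem_setOf_eq, Set.mem_empty_iff_false, iff_false, not_exists, not_and]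
      exact fun γ hγ _ => h ⟨γ, hγ⟩
    unfold chainDist
    rw [hempty, Nat.sInf_empty]
    exact Nat.zero_le _

open Classical in
/-- The **extended shortest-chain distance**: `chainDist` on joined pairs, the constant `|E| + 1` — longer than
every chain — on pairs that no chain joins. (definition) [cite: KorteVygen2002, §12.2 proof of Thm 12.9 (metric closure, extended to all of V)] -/
noncomputable def extDist (ι : E → Sym2 V) (a b : V) : ℕ :=
  if Joined ι s(a, b) then chainDist ι a b else Fintype.card E + 1

/-- On joined pairs the extended distance is the shortest-chain distance. [cite: KorteVygen2002, §12.2 proof of Thm 12.9] -/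
theorem extDist_of_joined {a b : V} (h : Joined ι s(a, b)) : extDist ι a b = chainDist ι a b := by
  unfold extDist; rw [if_pos h]

/-- On unjoined pairs the extended distance is `|E| + 1`. [cite: KorteVygen2002, §12.2 proof of Thm 12.9] -/
theorem extDist_of_not_joined {a b : V} (h : ¬ Joined ι s(a, b)) : extDist ι a b = Fintype.card E + 1 := by
  unfold extDist; rw [if_neg h]

/-- `extDist ≤ |E| + 1`. [cite: KorteVygen2002, §12.2 proof of Thm 12.9] -/
theorem extDist_le (a b : V) : extDist ι a b ≤ Fintype.card E + 1 := by
  by_cases h : Joined ι s(a, b)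
  · rw [extDist_of_joined h]; exact (chainDist_le_card a b).trans (Nat.le_succ _)
  · rw [extDist_of_not_joined h]

/-- Symmetry of the extended distance. [cite: KorteVygen2002, §12.2 proof of Thm 12.9] -/
theorem extDist_comm (a b : V) : extDist ι a b = extDist ι b a := by
  unfold extDist
  rw [Sym2.eq_swap, chainDist_comm]

/-- Triangle inequality for the extended distance. [cite: KorteVygen2002, §12.2 proof of Thm 12.9 (c̄ is a metric)] -/
theorem extDist_triangle [DecidableEq E] (a b c : V) : extDist ι a c ≤ extDist ι a b + extDist ι b c := by
  by_cases hab : Joined ι s(a, b)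
  · by_cases hbc : Joined ι s(b, c)
    · obtain ⟨γ₁, h₁, hn₁⟩ := hab.exists_chain
      obtain ⟨γ₂, h₂, hn₂⟩ := hbc.exists_chain
      have hγ : graphSyn ι (γ₁ + γ₂) = pairIndicator s(a, c) := by
        rw [graphSyn_add, h₁, h₂, pairIndicator_add_pairIndicator]
      rw [extDist_of_joined hab, extDist_of_joined hbc, extDist_of_joined (hab.trans hbc)]
      calc chainDist ι a c ≤ hammingNorm (γ₁ + γ₂) := chainDist_le_hammingNorm hγ
        _ ≤ hammingNorm γ₁ + hammingNorm γ₂ := hammingNorm_add_le_add γ₁ γ₂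
        _ = chainDist ι a b + chainDist ι b c := by rw [hn₁, hn₂]
    · rw [extDist_of_not_joined hbc]
      exact (extDist_le a c).trans (Nat.le_add_left _ _)
  · rw [extDist_of_not_joined hab]
    exact (extDist_le a c).trans (Nat.le_add_right _ _)

/-- A link has extended length `≤ 1`. [cite: KorteVygen2002, §12.2 proof of Thm 12.9 (c̄ ≤ c on edges)] -/
theorem extDist_ends_le_one [DecidableEq E] (ℓ : E) (a b : V) (h : ι ℓ = s(a, b)) : extDist ι a b ≤ 1 := by
  have hj : Joined ι s(a, b) := h ▸ joined_ends ℓ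
  rw [extDist_of_joined hj]
  exact chainDist_ends_le_one ℓ a b h

/-- **The extended shortest-chain metric** — an admissible MWPM link metric for EVERY graphlike model,
connected or not. [cite: KorteVygen2002, §12.2 proof of Thm 12.9 (metric closure (Ḡ, c̄))] -/
noncomputable def extMetric [DecidableEq E] (ι : E → Sym2 V) : EdgeMetric ι where
  d := extDist ι
  symm := extDist_comm
  triangle := extDist_triangle
  ends_le_one := extDist_ends_le_one

/-- `(extMetric ι).d = extDist ι`. [cite: KorteVygen2002, §12.2 proof of Thm 12.9] -/
@[simp] theorem extMetric_d [DecidableEq E] : (extMetric ι).d = extDist ι := rfl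

/-- **Matching decoders exist for every graphlike model** (no connectivity hypothesis): some decoder is a
minimum-weight-perfect-matching decoder for the extended shortest-chain metric — a minimum-cost perfect matching
of the defects of an actual error `e` costs `≤ |e| ≤ |E|` (Korte–Vygen Lemma 12.8), so it contains no unjoined
pair and every matched pair has a geodesic. [cite: KorteVygen2002, §12.2 Thm 12.9 with Prop 12.6] -/
theorem exists_isMatchingDecoder_extMetric [Fintype V] [DecidableEq E] :
    ∃ D, IsMatchingDecoder (extMetric ι) D := by
  classical
  -- geodesics on joined pairs, anything elsewhere
  have hgeo : ∀ p : Sym2 V, ∃ γ : E → ZMod 2,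
      Joined ι p → graphSyn ι γ = pairIndicator p ∧ hammingNorm γ ≤ (extMetric ι).pairCost p := by
    intro p
    induction p using Sym2.ind with
    | h a b =>
      by_cases h : Joined ι s(a, b)
      · obtain ⟨γ, hγ, hn⟩ := h.exists_chain
        refine ⟨γ, fun _ => ⟨hγ, ?_⟩⟩
        rw [EdgeMetric.pairCost_mk, extMetric_d, extDist_of_joined h, hn]
      · exact ⟨0, fun h' => absurd h' h⟩
  choose γ hγ using hgeo
  refine ⟨matchingDecoderOf (extMetric ι) γ, fun e => ?_⟩
  obtain ⟨M₁, hM₁, hc₁⟩ := (extMetric ι).exists_isPMOn_cost_le e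
  have hex : ∃ M, (extMetric ι).IsMinCostMatching (supp (graphSyn ι e)) M :=
    (extMetric ι).exists_isMinCostMatching ⟨M₁, hM₁⟩
  refine ⟨Classical.choose hex, Classical.choose_spec hex, γ, fun p hp => hγ p ?_, ?_⟩
  · -- every matched pair is joined: otherwise its cost `|E| + 1` exceeds `cost ≤ |e| ≤ |E|`
    obtain ⟨-, hmin⟩ := Classical.choose_spec hex
    have hcost : (extMetric ι).cost (Classical.choose hex) ≤ Fintype.card E :=
      ((hmin M₁ hM₁).trans hc₁).trans hammingNorm_le_card_fintype
    have hp' : (extMetric ι).pairCost p ≤ (extMetric ι).cost (Classical.choose hex) :=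
      single_le_sum (f := (extMetric ι).pairCost) (fun _ _ => Nat.zero_le _) hp
    by_contra hj
    induction p using Sym2.ind with
    | h a b =>
      rw [EdgeMetric.pairCost_mk, extMetric_d, extDist_of_not_joined hj] at hp'
      omega
  · unfold matchingDecoderOf
    rw [dif_pos hex]

/-- Hence **minimum-weight decoders obtained by matching exist for every graphlike model**.
[cite: KorteVygen2002, §12.2 Thm 12.9] -/
theorem exists_isMinWeight_of_matching [Fintype V] [DecidableEq E] :
    ∃ D : Decoder (V → ZMod 2) (E → ZMod 2), IsMatchingDecoder (extMetric ι) D ∧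
      D.IsMinWeight (graphSyn ι) (graphCycles ι) hammingNorm := by
  obtain ⟨D, hD⟩ := exists_isMatchingDecoder_extMetric (ι := ι)
  exact ⟨D, hD, hD.isMinWeight⟩

end Existence

end Literature.InformationTheory.QuantumCodes
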